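import Summits.BirchSwinnertonDyer.Rank1Residual.X11b.LocalH2Vanishing
import Summits.BirchSwinnertonDyer.Rank1Residual.GaloisImage.EPCTateFormula
import HarnessLib

/-!
# X11b, route R1 — the local finiteness / vanishing lemmas at `v ∤ p` made UNCONDITIONAL:
# `H¹(K_v, E[p^∞])` is finite and `H²(K_v, E[p^∞]) = 0`, the cited input `hEP` DISCHARGED
# (Tate's local Euler–Poincaré formula is the kernel theorem `GaloisImage.EPCTate.localEulerPoincareCharacteristic`)

HONEST FRAMING (cell `b2b-bsdres`, run/shared/lean/b2b/bsd-rank1-residual/, verbatim in every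
file): the goal of the cell is to DELETE the COMBINATION-SHAPED residual classes of the
Birch–Swinnerton-Dyer formula for ALL analytic-rank `≤ 1` elliptic curves over `ℚ` — "full BSD
formula for every rank `≤ 1` curve in class `C`" assembled STRICTLY from published theorems — so
that the rank-`≤ 1` remainder becomes exactly the CONSTRUCTION-SHAPED classes, which are TYPED
(missing-input `Prop`s), NOT attempted. This is not "finishing BSD". Sub-cell
`b2b-bsdres-multr1-p1` (X11b, route R1, gen 38); a RESEARCH ROUTE; no claim beyond the stated
class; X11b stays CONSTRUCTION-SHAPED; nothing here changes a label; THEOREMS ONLY — and the ones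
in this file are UNCONDITIONAL (no named-fact hypothesis, no open shape); no definition, no named
fact, no `sorry`.

## What this file does

`LocalPrimaryFinite.lean`, `LocalH2Transition.lean`, `LocalH2Vanishing.lean` (this route) and the
Literature file `EllipticCurves/LocalEulerCharacteristicTorsion.lean` prove their local-field
theorems GIVEN Milne *ADT* I Thm. 2.8 at `K_v` as a hypothesis
`hEP : localEulerPoincareCharacteristic (v.adicCompletion K)`. Team n1011's row T-EPC has proved
that fact in the kernel for every non-archimedean local field of characteristic `0`
(`GaloisImage.EPCTate.localEulerPoincareCharacteristic`, `GaloisImage/EPCTateFormula.lean`). This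
file supplies `hEP` at `K_v` and records the resulting UNCONDITIONAL statements (suffix `EP` = the
statement of record with the binder `hEP` discharged and nothing else changed):

* §1 `LocBridge.localEulerPoincareCharacteristic_adicCompletionEP` — Milne I 2.8 at `K_v` (the
  `Prop` itself); `LocBridge.localEulerPoincare_adicCompletionEP` — unfolded, with
  `𝓞_v = v.adicCompletionIntegers K`: for every finite discrete `Γ_{K_v}`-module `M`, `H¹(K_v, M)` and
  `H²(K_v, M)` are finite and `#M^{Γ} · #H²(K_v, M) · #(𝓞_v/(#M)) = #H¹(K_v, M)`;
  `LocBridge.natCard_galoisCohomology_one_torsion_adicCompletion_eq_sqEP` —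
  **`#H¹(K_v, E[n]) = (#E(K_v)[n] · #(𝓞_v/n))²`** for a prime power `n` and an elliptic curve `E/K`.
* §2 **`LocBridge.finite_galoisCohomology_one_primary_restrictFieldEP`** (and `…toLocalEP`) —
  **`H¹(K_v, E[p^∞])` is FINITE at every finite place `v ∤ p`** (Greenberg LNM 1716 §3 Lemma 3.3).
* §3 **`Levels.galoisCohomology_two_primary_eq_zeroEP`** (and
  `Levels.subsingleton_galoisCohomology_two_primary_toLocalEP`) — **`H²(K_v, E[p^∞]) = 0` at every
  finite place `v ∤ p`** (JSW17 §2.2.2, proof of Lemma 3.3.3).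

Consumers keep their `hEP` binders (`RouteR1LocSurj.lean`, `AnticyclotomicCoinvariants.lean`, …); the
records of route R1 with `hEP` discharged are in `RouteR1RecordsEP.lean`. Nothing of record is
touched (new file).

References: [MilneADT2006] I §2 Thm. 2.8 (p. 31), §3 Lemma 3.3; [GreenbergLNM1716] §3 Lemma 3.3
(p. 87); [JetchevSkinnerWan2017] §2.2.2, Lemma 3.3.3 (arXiv:1512.06894 pp. 6, 12);
[SerreGaloisCohomology1997] II §5.7 Thm. 5.
-/

noncomputable section

open scoped Classical

open CategoryTheory Field NumberField IsDedekindDomain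
open Literature.NumberTheory.EllipticCurves
open Literature.NumberTheory.GaloisRepresentations
open scoped ContRepresentation

universe u

/-! ### §1 Milne I Thm. 2.8 at `K_v`, discharged -/

namespace Summit.BirchSwinnertonDyer.Rank1Residual.X11b.LocBridge

section Place

variable (K : Type u) [Field K] [NumberField K] (v : HeightOneSpectrum (𝓞 K))

/-- **Tate's local Euler–Poincaré characteristic formula at the completion `K_v`** of a number field
at a finite place — the tree's `Prop` `localEulerPoincareCharacteristic (v.adicCompletion K)` (Milne
*ADT* I Thm. 2.8), i.e. exactly the binder `hEP` of this route's local files, now a theorem: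
`GaloisImage.EPCTate.localEulerPoincareCharacteristic` (team n1011, row T-EPC) at `K_v`.
[cite: MilneADT2006, I §2 Thm 2.8 (p. 31)] [cite: SerreGaloisCohomology1997, II §5.7 Thm. 5] -/
theorem localEulerPoincareCharacteristic_adicCompletionEP :
    localEulerPoincareCharacteristic (v.adicCompletion K) := by
  haveI : CharZero (v.adicCompletion K) :=
    charZero_of_injective_algebraMap (algebraMap K _).injective
  exact GaloisImage.EPCTate.localEulerPoincareCharacteristic (v.adicCompletion K)

/-- **Milne I Thm. 2.8 at `K_v`, unfolded, with `𝓞_v = v.adicCompletionIntegers K`** (UNCONDITIONAL):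
for every finite discrete `Γ_{K_v}`-module `M`, `H¹(K_v, M)` and `H²(K_v, M)` are finite and
`#M^{Γ_{K_v}} · #H²(K_v, M) · #(𝓞_v ⧸ (#M)𝓞_v) = #H¹(K_v, M)`. This is the Literature theorem
`localEulerPoincareCharacteristic_adicCompletion K v hEP ρ` with `hEP` discharged.
[cite: MilneADT2006, I §2 Thm 2.8 (p. 31)] -/
theorem localEulerPoincare_adicCompletionEP
    {M : Type u} [AddCommGroup M] [TopologicalSpace M] [DiscreteTopology M] [Finite M]
    (ρ : DiscreteGaloisModule (v.adicCompletion K) M) :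
    Finite (galoisCohomology ρ 1) ∧ Finite (galoisCohomology ρ 2) ∧
      Nat.card ρ.toTopRep.ρ.invariants * Nat.card (galoisCohomology ρ 2) *
          Nat.card (v.adicCompletionIntegers K ⧸
            Ideal.span {((Nat.card M : ℕ) : v.adicCompletionIntegers K)}) =
        Nat.card (galoisCohomology ρ 1) :=
  Literature.NumberTheory.EllipticCurves.localEulerPoincareCharacteristic_adicCompletion K v
    (localEulerPoincareCharacteristic_adicCompletionEP K v) ρ

end Place

section Curve

variable {K : Type u} [Field K] [NumberField K] (W : WeierstrassCurve K) [W.IsElliptic]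
  (v : HeightOneSpectrum (𝓞 K))

/-- **`#H¹(K_v, E[n]) = (#E(K_v)[n] · #(𝓞_v/n))²`** for an elliptic curve `E/K` over a number field,
a finite place `v` and a prime power `n` (UNCONDITIONAL): the Literature theorem
`natCard_galoisCohomology_one_torsion_adicCompletion_eq_sq` (Milne I 2.8 + local Tate duality for
`E[n]` + `#E[n] = n²`) with its binder `hEP` discharged. [cite: MilneADT2006, I §2 Thm 2.8, §3 Lemma 3.3] -/
theorem natCard_galoisCohomology_one_torsion_adicCompletion_eq_sqEP (n : ℕ) [NeZero n]
    (hn : IsPrimePow n) :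
    Nat.card (galoisCohomology
        (GaloisRep.restrictField (v.adicCompletion K) (W.torsionGaloisModule n)) 1) =
      (Nat.card (nsmulAddMonoidHom n :
            (W.baseChange (v.adicCompletion K)).toAffine.Point →+ _).ker *
          Nat.card (v.adicCompletionIntegers K ⧸
            Ideal.span {(n : v.adicCompletionIntegers K)})) ^ 2 :=
  natCard_galoisCohomology_one_torsion_adicCompletion_eq_sq W v n hn
    (localEulerPoincareCharacteristic_adicCompletionEP K v)

end Curve

/-! ### §2 `H¹(K_v, E[p^∞])` is finite at `v ∤ p`, unconditionally -/

section Finite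

variable {K : Type u} [Field K] [NumberField K] (W : WeierstrassCurve K) [W.IsElliptic] (p : ℕ)
  [Fact p.Prime] (v : HeightOneSpectrum (𝓞 K))

/-- **`H¹(K_v, E[p^∞])` is FINITE at every finite place `v ∤ p`** of a number field, for an elliptic
curve `E/K` (Greenberg LNM 1716 §3, proof of Lemma 3.3; JSW17 §2.2.2) — UNCONDITIONAL:
`finite_galoisCohomology_one_primary_restrictField` with Milne I 2.8 at `K_v` supplied by
`localEulerPoincareCharacteristic_adicCompletionEP`. (Restricted-module form.)
[cite: GreenbergLNM1716, §3 Lemma 3.3 (p. 87)] [cite: MilneADT2006, Ch. I §2, Thm. 2.8] -/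
theorem finite_galoisCohomology_one_primary_restrictFieldEP (hpv : (p : 𝓞 K) ∉ v.asIdeal) :
    Finite (galoisCohomology
      (GaloisRep.restrictField (v.adicCompletion K) (primaryGaloisModule W p)) 1) :=
  finite_galoisCohomology_one_primary_restrictField W p v
    (localEulerPoincareCharacteristic_adicCompletionEP K v) hpv

/-- **`H¹(K_v, E[p^∞])` is FINITE at every finite place `v ∤ p`**, in the `toLocal` form of the
Selmer-structure files — UNCONDITIONAL. [cite: GreenbergLNM1716, §3 Lemma 3.3 (p. 87)]
[cite: MilneADT2006, Ch. I §2, Thm. 2.8] -/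
theorem finite_galoisCohomology_one_primary_toLocalEP (hpv : (p : 𝓞 K) ∉ v.asIdeal) :
    Finite (galoisCohomology ((primaryGaloisModule W p).toLocal (Sum.inr v)) 1) :=
  finite_galoisCohomology_one_primary_toLocal W p v
    (localEulerPoincareCharacteristic_adicCompletionEP K v) hpv

end Finite

end Summit.BirchSwinnertonDyer.Rank1Residual.X11b.LocBridge

/-! ### §3 `H²(K_v, E[p^∞]) = 0` at `v ∤ p`, unconditionally -/

namespace Summit.BirchSwinnertonDyer.Rank1Residual.X11b.Levels

section Vanishing

variable {K : Type u} [Field K] [NumberField K] (W : WeierstrassCurve K) [W.IsElliptic] (p : ℕ)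
  [Fact p.Prime] (v : HeightOneSpectrum (𝓞 K))

/-- **`H²(K_v, E[p^∞]) = 0` at every finite place `v ∤ p`** of a number field, for an elliptic curve
`E/K` (JSW17 §2.2.2 / proof of Lemma 3.3.3: "`H²(K_w, W)` is dual to `H⁰(K_w, T)`, and the latter is
`0`") — UNCONDITIONAL: `galoisCohomology_two_primary_eq_zero` with Milne I 2.8 at `K_v` supplied by
`LocBridge.localEulerPoincareCharacteristic_adicCompletionEP`.
[cite: JetchevSkinnerWan2017, §2.2.2 and Lemma 3.3.3 (arXiv:1512.06894 pp. 6, 12)]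
[cite: MilneADT2006, Ch. I §2, Thm. 2.8 and Cor. 2.3] -/
theorem galoisCohomology_two_primary_eq_zeroEP (hpv : (p : 𝓞 K) ∉ v.asIdeal)
    (Z : galoisCohomology (GaloisRep.restrictField (v.adicCompletion K)
      (LocBridge.primaryGaloisModule W p)) 2) : Z = 0 :=
  galoisCohomology_two_primary_eq_zero W p v
    (LocBridge.localEulerPoincareCharacteristic_adicCompletionEP K v) hpv Z

/-- **`H²(K_v, E[p^∞]) = 0` at `v ∤ p`**, in the `toLocal` form of the Selmer-structure files —
UNCONDITIONAL. [cite: JetchevSkinnerWan2017, §2.2.2 (arXiv:1512.06894 p. 6)] -/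
theorem subsingleton_galoisCohomology_two_primary_toLocalEP (hpv : (p : 𝓞 K) ∉ v.asIdeal) :
    Subsingleton (galoisCohomology ((LocBridge.primaryGaloisModule W p).toLocal (Sum.inr v)) 2) :=
  subsingleton_galoisCohomology_two_primary_toLocal W p v
    (LocBridge.localEulerPoincareCharacteristic_adicCompletionEP K v) hpv

end Vanishing

end Summit.BirchSwinnertonDyer.Rank1Residual.X11b.Levels

end
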